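import Mathlib.Analysis.SpecialFunctions.Pow.Real
import Mathlib.Tactic.Linarith
import Mathlib.Tactic.Positivity
import Mathlib.Tactic.Ring
import HarnessLib

/-!
# `NoHeavyLowerTail` (stmt-CriticalPhenomena-4575) — CONJECTURE F under apex piece-union: the mixed-leaning union lemma (LEMMA U″, hand proof)

Support file (prover prim-ineq-gen-8 gen 35; `--supports stmt-CriticalPhenomena-4575`; memo
run/shared/lean/prim/prim-ineq-gen-8/FINDING-gen35-CONJF-UNION.md).  Pure real algebra: no definitions, no named facts, no sorries.
It closes the one leaf left open by gen 34 (memo FINDING-gen34-CONJF.md §0(5), "u ∈ H_b, v ∈ H_c") of the union lemma behind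
THEOREM F_T (prim-cert-1's CONJECTURE F on every finite weighted graph `G` with `G ∖ {b,c}` a forest), by a one-page argument
instead of a certificate.

SETTING (normalised gadget coordinates, as in `…APLGeometricClosure.lean`).  An instance `(a; b, c)` with cells
`u0 = P(a|b|c), uab = P(ab|c), uac = P(ac|b), ubc = P(a|bc), u3 = P(abc)` and total mass `1` is described by
`D = u0+uab+uac = P(b ↮ c)`, `x = uab/D`, `y = uac/D` and `r = uab+uac+u3 = P(a ↔ {b,c})`.  In these coordinates
* Harris: `x + y ≤ r`;  APL-G (gen 29, the geometric form of APL): `(r − x − y)² ≤ x·y`;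
* `F_c : 2r ≤ 3(x+y) − D(x−y)`,  `F_b : 2r ≤ 3(x+y) + D(x−y)`  (prim-cert-1's CONJECTURE F is `F_b ∧ F_c`);
* `u0 ≥ uab+uac ⟺ x + y ≤ 1/2`,  `ubc ≥ uab+uac ⟺ D ≤ 1 − r`,  b-leaning `⟺ y ≤ x`.
For two instances `u = (D,x,y,r)`, `v = (D',x',y',r')` meeting only in `{a,b,c}` the apex piece-union `w = u ∪ v` has
`F_c(w) = D·D'·Φ` with (gen 34 memo §0(2), all masses `1`)
`Φ = (1 − (x y' + y x'))·(1 + 2(1−r)(1−r') − D D'·M) − 3(1−x−y)(1−x'−y')`, `M = (x−y)(1−(x'+y')/2) − (y'−x')(1−(x+y)/2)`.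

THEOREM (`conjF_c_union_mixed_norm`).  If `u` is b-leaning with `x+y ≤ 1/2`, Harris, APL-G and `F_c`, and `v` is c-leaning with
`x'+y' ≤ 1/2`, Harris, APL-G and `D' ≤ 1 − r'`, then `Φ ≥ 0`.  (Neither GZ (5.1) nor `F` for `v` is needed.)

PROOF.  With `p = √x, q = √y`, `h = x−y`, `g = (p−q)²`, `σ = 3(x+y) − 2r` (twice the APL(2/3)-slack; APL-G ⟺ `σ ≥ g`,
`F_c ⟺ σ ≥ hD`), `a' = 1−r'`, `κ = 1 − (xy'+yx')`, `A = 2 − 3(x+y)`, `s = Q+Q'−(3/2)QQ'` one has the MASTER IDENTITY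
`Φ = (3/2)((QQ'+hh')s − hh') + κσ'A/2 + κσa' − κDD'(h(1−Q'/2) − h'(1−Q/2))` (`ring`).  If `E := h(1−Q'/2) − h'(1−Q/2) ≤ 0`
then `Φ ≥ I₁ := (3/2)((QQ'+hh')s − hh') + κg'A/2 + κ g a'_A` (`a'_A = 1 − 3Q'/2 + g'/2 ≤ a'`); if `E > 0` then, with
`τ = (p−q)/(p+q)` and the two cases `D ≷ τ`, `Φ ≥ I₃ := (3/2)((QQ'+hh')s − hh') + κg'A/2 + κ a'_A τ (hQ'/2 + h'(1−Q/2))`.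
`I₁, I₃ ≥ 0` (`conjF_union_coreI1/3`): trivial when `s ≥ 1/2`; otherwise the only negative term `(3/2)hh'(1−2s)` is absorbed by
AM–GM (`h² ≤ 2Qg`) resp. by `h = τ(p+q)² ≤ 2Qτ`, reducing to `κ²A a'_A ≥ (9/2)QQ'(1−2s)²` and `κ a'_A(1−Q/2) ≥ 3Q(1−2s)`,
which follow from `Q(1−2Q) ≤ 1/8` and `(1−Q/2)² ≥ 3Q(1−2Q)`.
[folklore algebra; the percolation meaning and the forest induction (THEOREM F_T) are in the memo]
-/

namespace Summit.CriticalPhenomena.PercolationContinuityZ3.Theorems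

namespace APL

/-- A binary quadratic form with positive leading coefficient and nonpositive discriminant is nonnegative. [folklore] -/
theorem conjF_quadForm_nonneg (a b c x y : ℝ) (ha : 0 < a) (h : b^2 ≤ a*c) :
    0 ≤ a*x^2 - 2*b*x*y + c*y^2 := by
  have key : a * (a*x^2 - 2*b*x*y + c*y^2) = (a*x - b*y)^2 + (a*c - b^2)*y^2 := by ring
  have hnn : a * 0 ≤ a * (a*x^2 - 2*b*x*y + c*y^2) := by
    rw [mul_zero, key]; nlinarith [sq_nonneg (a*x - b*y), sq_nonneg y]
  exact le_of_mul_le_mul_left hnn ha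

/-- The master identity for the `F_c`-slack of an apex piece-union in square-root gadget coordinates
(`x = p², y = q²`, `x' = p'², y' = q'²`): the only negative term is `−(3/2)·h·h'`. [folklore] -/
theorem conjF_union_master_identity (D p q r D' p' q' r' : ℝ) :
    (1 - (p^2*q'^2 + q^2*p'^2)) * (1 + 2*(1-r)*(1-r')
        - D*D'*((p^2-q^2)*(1-(p'^2+q'^2)/2) - (q'^2-p'^2)*(1-(p^2+q^2)/2)))
      - 3*(1-(p^2+q^2))*(1-(p'^2+q'^2))
    = 3/2*(((p^2+q^2)*(p'^2+q'^2) + (p^2-q^2)*(q'^2-p'^2))*((p^2+q^2)+(p'^2+q'^2)-3/2*(p^2+q^2)*(p'^2+q'^2))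
          - (p^2-q^2)*(q'^2-p'^2))
      + (1 - (p^2*q'^2 + q^2*p'^2))*(3*(p'^2+q'^2)-2*r')*(2-3*(p^2+q^2))/2
      + (1 - (p^2*q'^2 + q^2*p'^2))*(3*(p^2+q^2)-2*r)*(1-r')
      - (1 - (p^2*q'^2 + q^2*p'^2))*D*D'*((p^2-q^2)*(1-(p'^2+q'^2)/2) - (q'^2-p'^2)*(1-(p^2+q^2)/2)) := by
  ring

set_option maxHeartbeats 800000 in
/-- Core inequality `I₁ ≥ 0` (the branch `E ≤ 0`): `(3/2)((QQ'+hh')s − hh') + κg'(2−3Q)/2 + κ g a_A ≥ 0` under the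
listed bounds; the negative part `(3/2)hh'(1−2s)` is absorbed by the quadratic form `κQA·h'² + 2κQ'a_A·h²`. [folklore] -/
theorem conjF_union_coreI1 (Q Q' h h' g g' κ aA : ℝ)
    (hQ0 : 0 ≤ Q) (hQ : Q ≤ 1/2) (hQ0' : 0 ≤ Q') (hQ' : Q' ≤ 1/2)
    (hh0 : 0 ≤ h) (hh : h ≤ Q) (hh0' : 0 ≤ h') (hh' : h' ≤ Q')
    (hg : 0 ≤ g) (hg' : 0 ≤ g') (hgh : h^2 ≤ 2*Q*g) (hgh' : h'^2 ≤ 2*Q'*g')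
    (hκ : 3/4 ≤ κ) (haA : 1 - 3/2*Q' ≤ aA) :
    0 ≤ 3/2*((Q*Q'+h*h')*(Q+Q'-3/2*Q*Q') - h*h') + κ*g'*(2-3*Q)/2 + κ*g*aA := by
  have hQQ0 : 0 ≤ Q*Q' := mul_nonneg hQ0 hQ0'
  have hs0 : 0 ≤ Q+Q'-3/2*Q*Q' := by
    have := mul_le_mul_of_nonneg_left hQ' hQ0; linarith
  have hA0 : 0 ≤ 2 - 3*Q := by linarith
  have haA0 : 0 ≤ aA := by linarith
  have hκ0 : 0 ≤ κ := by linarith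
  have hhh : h*h' ≤ Q*Q' := mul_le_mul hh hh' hh0' hQ0
  have hX : 0 ≤ κ*g'*(2-3*Q)/2 := by
    have := mul_nonneg (mul_nonneg hκ0 hg') hA0; linarith
  have hY : 0 ≤ κ*g*aA := mul_nonneg (mul_nonneg hκ0 hg) haA0
  rcases le_or_gt (1/2) (Q+Q'-3/2*Q*Q') with hcase | hcase
  · have hb : 0 ≤ (Q*Q'+h*h')*(Q+Q'-3/2*Q*Q') - h*h' := by
      have := mul_le_mul_of_nonneg_left hcase (add_nonneg hQQ0 (mul_nonneg hh0 hh0'))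
      linarith
    linarith
  · have ht0 : 0 < 1 - 2*(Q+Q'-3/2*Q*Q') := by linarith
    have ht1' : 1 - 2*(Q+Q'-3/2*Q*Q') ≤ 1 := by linarith
    have hb : -(3/2*h*h'*(1-2*(Q+Q'-3/2*Q*Q'))) ≤ 3/2*((Q*Q'+h*h')*(Q+Q'-3/2*Q*Q') - h*h') := by
      have e : 3/2*((Q*Q'+h*h')*(Q+Q'-3/2*Q*Q') - h*h') + 3/2*h*h'*(1-2*(Q+Q'-3/2*Q*Q'))
          = 3/2*((Q*Q' - h*h')*(Q+Q'-3/2*Q*Q')) := by ring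
      have := mul_nonneg (sub_nonneg.2 hhh) hs0
      linarith
    by_cases hQQ : Q*Q' = 0
    · have hzero : h*h' = 0 := by
        rcases mul_eq_zero.mp hQQ with h0 | h0
        · have : h = 0 := le_antisymm (by rw [h0] at hh; exact hh) hh0
          rw [this, zero_mul]
        · have : h' = 0 := le_antisymm (by rw [h0] at hh'; exact hh') hh0'
          rw [this, mul_zero]
      have : 3/2*h*h'*(1-2*(Q+Q'-3/2*Q*Q')) = 0 := by
        rw [show 3/2*h*h'*(1-2*(Q+Q'-3/2*Q*Q')) = 3/2*(h*h')*(1-2*(Q+Q'-3/2*Q*Q')) by ring, hzero]; ring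
      linarith
    · have hQQpos : 0 < Q*Q' := lt_of_le_of_ne hQQ0 (Ne.symm hQQ)
      have hQpos : 0 < Q := by
        rcases lt_or_eq_of_le hQ0 with hq | hq
        · exact hq
        · exfalso; apply hQQ; rw [← hq, zero_mul]
      -- discriminant condition  (3QQ't)² ≤ (κQA)(2κQ'a_A)
      have hpsd : (3*Q*Q'*(1-2*(Q+Q'-3/2*Q*Q')))^2 ≤ (κ*Q*(2-3*Q)) * (2*κ*Q'*aA) := by
        have hprod0 : 0 ≤ (1-2*Q)*(1-2*Q') := mul_nonneg (by linarith) (by linarith)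
        have htle : 1-2*(Q+Q'-3/2*Q*Q') ≤ (1-2*Q)*(1-2*Q') := by
          have e : (1-2*Q)*(1-2*Q') - (1-2*(Q+Q'-3/2*Q*Q')) = Q*Q' := by ring
          linarith
        have ht1 : (1-2*(Q+Q'-3/2*Q*Q'))^2 ≤ (1-2*Q)*(1-2*Q') := by
          have s1 : (1-2*(Q+Q'-3/2*Q*Q'))*(1-2*(Q+Q'-3/2*Q*Q')) ≤ (1-2*(Q+Q'-3/2*Q*Q'))*((1-2*Q)*(1-2*Q')) :=
            mul_le_mul_of_nonneg_left htle (le_of_lt ht0)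
          have s2 : (1-2*(Q+Q'-3/2*Q*Q'))*((1-2*Q)*(1-2*Q')) ≤ 1*((1-2*Q)*(1-2*Q')) :=
            mul_le_mul_of_nonneg_right ht1' hprod0
          nlinarith
        have hq8 : Q*(1-2*Q) ≤ 1/8 := by nlinarith [sq_nonneg (Q-1/4)]
        have hq8' : Q'*(1-2*Q') ≤ 1/8 := by nlinarith [sq_nonneg (Q'-1/4)]
        have step1 : Q*Q'*(1-2*(Q+Q'-3/2*Q*Q'))^2 ≤ 1/64 := by
          calc Q*Q'*(1-2*(Q+Q'-3/2*Q*Q'))^2 ≤ Q*Q'*((1-2*Q)*(1-2*Q')) :=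
                mul_le_mul_of_nonneg_left ht1 hQQ0
            _ = (Q*(1-2*Q))*(Q'*(1-2*Q')) := by ring
            _ ≤ (1/8)*(1/8) := mul_le_mul hq8 hq8' (mul_nonneg hQ0' (by linarith)) (by norm_num)
            _ = 1/64 := by norm_num
        have hAa : 1/2 ≤ (2-3*Q)*aA := by
          have s1 := mul_le_mul_of_nonneg_left haA hA0
          have e : (2-3*Q)*(1 - 3/2*Q') = 2 - 3*(Q+Q'-3/2*Q*Q') := by ring
          linarith
        have hκ2 : 9/16 ≤ κ^2 := by
          have := mul_le_mul hκ hκ (by norm_num) hκ0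
          nlinarith
        have r3 : 9/16*(1/2) ≤ κ^2*((2-3*Q)*aA) := mul_le_mul hκ2 hAa (by norm_num) (sq_nonneg κ)
        have r4 : 9*(Q*Q'*(1-2*(Q+Q'-3/2*Q*Q'))^2) ≤ 2*(κ^2*((2-3*Q)*aA)) := by linarith
        have r5 := mul_le_mul_of_nonneg_left r4 hQQ0
        have r1 : (3*Q*Q'*(1-2*(Q+Q'-3/2*Q*Q')))^2 = (Q*Q')*(9*(Q*Q'*(1-2*(Q+Q'-3/2*Q*Q'))^2)) := by ring
        have r2 : (κ*Q*(2-3*Q)) * (2*κ*Q'*aA) = (Q*Q')*(2*(κ^2*((2-3*Q)*aA))) := by ring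
        rw [r1, r2]; exact r5
      have hapos : 0 < κ*Q*(2-3*Q) :=
        mul_pos (mul_pos (by linarith) hQpos) (by linarith)
      have hqf := conjF_quadForm_nonneg (κ*Q*(2-3*Q)) (3*Q*Q'*(1-2*(Q+Q'-3/2*Q*Q'))) (2*κ*Q'*aA) h' h hapos hpsd
      have e4 : 4*(Q*Q')*(κ*g'*(2-3*Q)/2 + κ*g*aA - 3/2*h*h'*(1-2*(Q+Q'-3/2*Q*Q')))
          = κ*Q*(2-3*Q)*(2*Q'*g') + 2*κ*Q'*aA*(2*Q*g) - 2*(3*Q*Q'*(1-2*(Q+Q'-3/2*Q*Q')))*h'*h := by ring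
      have m1 : κ*Q*(2-3*Q)*h'^2 ≤ κ*Q*(2-3*Q)*(2*Q'*g') := mul_le_mul_of_nonneg_left hgh' (le_of_lt hapos)
      have m2 : 2*κ*Q'*aA*h^2 ≤ 2*κ*Q'*aA*(2*Q*g) :=
        mul_le_mul_of_nonneg_left hgh (by
          have := mul_nonneg (mul_nonneg hκ0 hQ0') haA0; linarith)
      have h4 : 4*(Q*Q') * 0 ≤ 4*(Q*Q')*(κ*g'*(2-3*Q)/2 + κ*g*aA - 3/2*h*h'*(1-2*(Q+Q'-3/2*Q*Q'))) := by
        rw [mul_zero, e4]; linarith [hqf, m1, m2]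
      have h5 : 0 ≤ κ*g'*(2-3*Q)/2 + κ*g*aA - 3/2*h*h'*(1-2*(Q+Q'-3/2*Q*Q')) :=
        le_of_mul_le_mul_left h4 (by linarith)
      linarith

set_option maxHeartbeats 800000 in
/-- Core inequality `I₃ ≥ 0` (the branch `E > 0`): with `h = τ·m₂`, `m₂ = (p+q)² ≤ 2Q`, the term `κ a_A τ h'(1−Q/2)`
dominates `(3/2)hh'(1−2s)` because `κ a_A (1−Q/2) ≥ 3Q(1−2s)`. [folklore] -/
theorem conjF_union_coreI3 (Q Q' h h' g' κ aA τ m2 : ℝ)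
    (hQ0 : 0 ≤ Q) (hQ : Q ≤ 1/2) (hQ0' : 0 ≤ Q') (hQ' : Q' ≤ 1/2)
    (hh0 : 0 ≤ h) (hh : h ≤ Q) (hh0' : 0 ≤ h') (hh' : h' ≤ Q')
    (hg' : 0 ≤ g') (hκ : 1 - Q/2 ≤ κ) (haA : 1 - 3/2*Q' ≤ aA)
    (hτ : 0 ≤ τ) (hm2Q : m2 ≤ 2*Q) (hhτ : h = τ*m2) :
    0 ≤ 3/2*((Q*Q'+h*h')*(Q+Q'-3/2*Q*Q') - h*h') + κ*g'*(2-3*Q)/2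
        + κ*aA*τ*(h*Q'/2 + h'*(1-Q/2)) := by
  have hQQ0 : 0 ≤ Q*Q' := mul_nonneg hQ0 hQ0'
  have hs0 : 0 ≤ Q+Q'-3/2*Q*Q' := by
    have := mul_le_mul_of_nonneg_left hQ' hQ0; linarith
  have hA0 : 0 ≤ 2 - 3*Q := by linarith
  have haA0 : 0 ≤ aA := by linarith
  have hκ0 : 0 ≤ κ := by linarith
  have hv : 0 ≤ 1 - Q/2 := by linarith
  have hw : 0 ≤ 1 - 3/2*Q' := by linarith
  have hhh : h*h' ≤ Q*Q' := mul_le_mul hh hh' hh0' hQ0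
  have hX : 0 ≤ κ*g'*(2-3*Q)/2 := by
    have := mul_nonneg (mul_nonneg hκ0 hg') hA0; linarith
  have hZ1 : 0 ≤ κ*aA*τ*(h*Q'/2) := by
    have := mul_nonneg (mul_nonneg (mul_nonneg hκ0 haA0) hτ) (mul_nonneg hh0 hQ0'); linarith
  have hZ2 : 0 ≤ κ*aA*τ*(h'*(1-Q/2)) :=
    mul_nonneg (mul_nonneg (mul_nonneg hκ0 haA0) hτ) (mul_nonneg hh0' hv)
  have hsplit : κ*aA*τ*(h*Q'/2 + h'*(1-Q/2)) = κ*aA*τ*(h*Q'/2) + κ*aA*τ*(h'*(1-Q/2)) := by ring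
  rcases le_or_gt (1/2) (Q+Q'-3/2*Q*Q') with hcase | hcase
  · have hb : 0 ≤ (Q*Q'+h*h')*(Q+Q'-3/2*Q*Q') - h*h' := by
      have := mul_le_mul_of_nonneg_left hcase (add_nonneg hQQ0 (mul_nonneg hh0 hh0'))
      linarith
    linarith
  · have ht0 : 0 < 1 - 2*(Q+Q'-3/2*Q*Q') := by linarith
    have hb : -(3/2*h*h'*(1-2*(Q+Q'-3/2*Q*Q'))) ≤ 3/2*((Q*Q'+h*h')*(Q+Q'-3/2*Q*Q') - h*h') := by
      have e : 3/2*((Q*Q'+h*h')*(Q+Q'-3/2*Q*Q') - h*h') + 3/2*h*h'*(1-2*(Q+Q'-3/2*Q*Q'))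
          = 3/2*((Q*Q' - h*h')*(Q+Q'-3/2*Q*Q')) := by ring
      have := mul_nonneg (sub_nonneg.2 hhh) hs0
      linarith
    -- κ aA (1-Q/2) ≥ 3Q(1-2s)
    have t1 : 1-2*(Q+Q'-3/2*Q*Q') ≤ (1-2*Q)*(1-3/2*Q') := by
      have e : (1-2*Q)*(1-3/2*Q') - (1-2*(Q+Q'-3/2*Q*Q')) = Q'/2 := by ring
      linarith
    have t2 : 3*Q*(1-2*Q) ≤ (1-Q/2)^2 := by nlinarith [sq_nonneg (5/2*Q - 4/5)]
    have c0 : (1-Q/2)*(1-3/2*Q') ≤ κ*aA := mul_le_mul hκ haA hw hκ0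
    have c1 : 3*Q*(1-2*(Q+Q'-3/2*Q*Q')) ≤ κ*aA*(1-Q/2) := by
      have s1 : 3*Q*(1-2*(Q+Q'-3/2*Q*Q')) ≤ 3*Q*((1-2*Q)*(1-3/2*Q')) :=
        mul_le_mul_of_nonneg_left t1 (by linarith)
      have s2 : 3*Q*((1-2*Q)*(1-3/2*Q')) = (3*Q*(1-2*Q))*(1-3/2*Q') := by ring
      have s3 : (3*Q*(1-2*Q))*(1-3/2*Q') ≤ (1-Q/2)^2*(1-3/2*Q') := mul_le_mul_of_nonneg_right t2 hw
      have s4 : (1-Q/2)^2*(1-3/2*Q') = ((1-Q/2)*(1-3/2*Q'))*(1-Q/2) := by ring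
      have s5 : ((1-Q/2)*(1-3/2*Q'))*(1-Q/2) ≤ (κ*aA)*(1-Q/2) := mul_le_mul_of_nonneg_right c0 hv
      linarith
    have c2 : 3/2*m2*(1-2*(Q+Q'-3/2*Q*Q')) ≤ κ*aA*(1-Q/2) := by
      have := mul_le_mul_of_nonneg_right hm2Q (le_of_lt ht0)
      linarith
    have c3 : 3/2*h*h'*(1-2*(Q+Q'-3/2*Q*Q')) ≤ κ*aA*τ*(h'*(1-Q/2)) := by
      have e1 : 3/2*h*h'*(1-2*(Q+Q'-3/2*Q*Q')) = (τ*h')*(3/2*m2*(1-2*(Q+Q'-3/2*Q*Q'))) := by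
        rw [hhτ]; ring
      have e2 : κ*aA*τ*(h'*(1-Q/2)) = (τ*h')*(κ*aA*(1-Q/2)) := by ring
      rw [e1, e2]
      exact mul_le_mul_of_nonneg_left c2 (mul_nonneg hτ hh0')
    linarith

set_option maxHeartbeats 1600000 in
/-- **LEMMA U″, mixed-leaning leaf (b-leaning `u`, c-leaning `v`), target `F_c`.**  In normalised gadget coordinates
(`D = P(b↮c)`, `x = P(ab|c)/D`, `y = P(ac|b)/D`, `r = P(a↔{b,c})`, total mass `1`): if `u = (D,x,y,r)` satisfies
`y ≤ x`, `x+y ≤ 1/2` (`u0 ≥ e_u`), Harris `x+y ≤ r`, APL-G `(r−x−y)² ≤ xy` and `F_c : 2r ≤ 3(x+y) − D(x−y)`, and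
`v = (D',x',y',r')` satisfies `x' ≤ y'`, `x'+y' ≤ 1/2`, Harris, APL-G and `D' ≤ 1 − r'` (`vbc ≥ e_v`), then the
`F_c`-slack `Φ` of the apex piece-union (`F_c(u ∪ v) = D·D'·Φ`) is nonnegative.  GZ (5.1) and `F(v)` are not used. [folklore] -/
theorem conjF_c_union_mixed_norm (D x y r D' x' y' r' : ℝ)
    (hy : 0 ≤ y) (hyx : y ≤ x) (hQ : x + y ≤ 1/2) (hD : 0 ≤ D)
    (hl : x + y ≤ r) (hg : (r - x - y)^2 ≤ x*y) (hF : 2*r ≤ 3*(x+y) - D*(x-y))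
    (hx' : 0 ≤ x') (hxy' : x' ≤ y') (hQ' : x' + y' ≤ 1/2) (hD' : 0 ≤ D')
    (hl' : x' + y' ≤ r') (hg' : (r' - x' - y')^2 ≤ x'*y') (hbc : D' ≤ 1 - r') :
    0 ≤ (1 - (x*y' + y*x')) * (1 + 2*(1-r)*(1-r')
          - D*D'*((x-y)*(1-(x'+y')/2) - (y'-x')*(1-(x+y)/2)))
        - 3*(1-(x+y))*(1-(x'+y')) := by
  have hx : 0 ≤ x := le_trans hy hyx
  have hy' : 0 ≤ y' := le_trans hx' hxy'
  -- square-root coordinates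
  obtain ⟨p, hp0, hp2⟩ : ∃ p : ℝ, 0 ≤ p ∧ p^2 = x := ⟨Real.sqrt x, Real.sqrt_nonneg _, Real.sq_sqrt hx⟩
  obtain ⟨q, hq0, hq2⟩ : ∃ q : ℝ, 0 ≤ q ∧ q^2 = y := ⟨Real.sqrt y, Real.sqrt_nonneg _, Real.sq_sqrt hy⟩
  obtain ⟨p', hp0', hp2'⟩ : ∃ p' : ℝ, 0 ≤ p' ∧ p'^2 = x' := ⟨Real.sqrt x', Real.sqrt_nonneg _, Real.sq_sqrt hx'⟩
  obtain ⟨q', hq0', hq2'⟩ : ∃ q' : ℝ, 0 ≤ q' ∧ q'^2 = y' := ⟨Real.sqrt y', Real.sqrt_nonneg _, Real.sq_sqrt hy'⟩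
  have hgle : r - x - y ≤ p*q := by
    have h1 : (r - x - y)^2 ≤ (p*q)^2 := by rw [mul_pow, hp2, hq2]; exact hg
    have h2 := Real.sqrt_le_sqrt h1
    rwa [Real.sqrt_sq (show 0 ≤ r - x - y by linarith), Real.sqrt_sq (mul_nonneg hp0 hq0)] at h2
  have hgle' : r' - x' - y' ≤ p'*q' := by
    have h1 : (r' - x' - y')^2 ≤ (p'*q')^2 := by rw [mul_pow, hp2', hq2']; exact hg'
    have h2 := Real.sqrt_le_sqrt h1
    rwa [Real.sqrt_sq (show 0 ≤ r' - x' - y' by linarith), Real.sqrt_sq (mul_nonneg hp0' hq0')] at h2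
  subst hp2 hq2 hp2' hq2'
  have hqp : q ≤ p := by
    by_contra hc
    have hc' : p < q := lt_of_not_ge hc
    have := mul_pos (sub_pos.2 hc') (add_pos_of_pos_of_nonneg (lt_of_le_of_lt hp0 hc') hp0)
    nlinarith
  have hpq' : p' ≤ q' := by
    by_contra hc
    have hc' : q' < p' := lt_of_not_ge hc
    have := mul_pos (sub_pos.2 hc') (add_pos_of_pos_of_nonneg (lt_of_le_of_lt hq0' hc') hq0')
    nlinarith
  -- the master identity, then atomise
  rw [conjF_union_master_identity D p q r D' p' q' r']
  set Q := p^2+q^2 with hQdef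
  set Q' := p'^2+q'^2 with hQ'def
  set h := p^2-q^2 with hhdef
  set h' := q'^2-p'^2 with hh'def
  set κ := 1 - (p^2*q'^2 + q^2*p'^2) with hκdef
  set σ := 3*Q-2*r with hσdef
  set σ' := 3*Q'-2*r' with hσ'def
  set a' := 1 - r' with ha'def
  -- facts about the atoms
  have hQ0 : 0 ≤ Q := by rw [hQdef]; positivity
  have hQ0' : 0 ≤ Q' := by rw [hQ'def]; positivity
  have hh0 : 0 ≤ h := by rw [hhdef]; nlinarith [mul_le_mul hqp hqp hq0 hp0]
  have hhQ : h ≤ Q := by rw [hhdef, hQdef]; nlinarith [sq_nonneg q]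
  have hh0' : 0 ≤ h' := by rw [hh'def]; nlinarith [mul_le_mul hpq' hpq' hp0' hq0']
  have hhQ' : h' ≤ Q' := by rw [hh'def, hQ'def]; nlinarith [sq_nonneg p']
  have hfac : h = (p-q)*(p+q) := by rw [hhdef]; ring
  have hgQ : (p-q)^2 = Q - 2*(p*q) := by rw [hQdef]; ring
  have hgQ' : (q'-p')^2 = Q' - 2*(p'*q') := by rw [hQ'def]; ring
  have hgh : h^2 ≤ 2*Q*(p-q)^2 := by
    have e : 2*Q*(p-q)^2 - h^2 = ((p-q)^2)^2 := by rw [hQdef, hhdef]; ring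
    nlinarith [sq_nonneg ((p-q)^2)]
  have hgh' : h'^2 ≤ 2*Q'*(q'-p')^2 := by
    have e : 2*Q'*(q'-p')^2 - h'^2 = ((q'-p')^2)^2 := by rw [hQ'def, hh'def]; ring
    nlinarith [sq_nonneg ((q'-p')^2)]
  have hm2 : (p+q)^2 ≤ 2*Q := by
    have e : 2*Q - (p+q)^2 = (p-q)^2 := by rw [hQdef]; ring
    nlinarith [sq_nonneg (p-q)]
  have hσg : (p-q)^2 ≤ σ := by rw [hσdef, hgQ]; linarith
  have hσg' : (q'-p')^2 ≤ σ' := by rw [hσ'def, hgQ']; linarith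
  have haA : 1 - 3/2*Q' + (q'-p')^2/2 ≤ a' := by rw [ha'def, hgQ']; linarith
  have hσh : h*D ≤ σ := by rw [hσdef]; linarith
  have hCQ : p^2*q'^2 + q^2*p'^2 ≤ Q*Q' := by
    have e : Q*Q' - (p^2*q'^2 + q^2*p'^2) = p^2*p'^2 + q^2*q'^2 := by rw [hQdef, hQ'def]; ring
    nlinarith [mul_nonneg (sq_nonneg p) (sq_nonneg p'), mul_nonneg (sq_nonneg q) (sq_nonneg q')]
  have hQQ : Q*Q' ≤ 1/2*(1/2) := mul_le_mul hQ hQ' hQ0' (by norm_num)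
  have hQQ2 : Q*Q' ≤ Q*(1/2) := mul_le_mul_of_nonneg_left hQ' hQ0
  have hκ34 : 3/4 ≤ κ := by rw [hκdef]; linarith
  have hκQ : 1 - Q/2 ≤ κ := by rw [hκdef]; linarith
  have hκ0 : 0 ≤ κ := by linarith
  have ha'0 : 0 ≤ a' := le_trans hD' hbc
  have hA0 : 0 ≤ 2 - 3*Q := by linarith
  have hv : 0 ≤ 1 - Q/2 := by linarith
  -- I₁ is available in every branch
  have hI1 := conjF_union_coreI1 Q Q' h h' ((p-q)^2) ((q'-p')^2) κ (1 - 3/2*Q' + (q'-p')^2/2)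
    hQ0 hQ hQ0' hQ' hh0 hhQ hh0' hhQ' (sq_nonneg _) (sq_nonneg _) hgh hgh' hκ34 (by
      have := sq_nonneg (q'-p'); linarith)
  have hX : κ*(q'-p')^2*(2-3*Q)/2 ≤ κ*σ'*(2-3*Q)/2 := by
    have := mul_le_mul_of_nonneg_left hσg' (mul_nonneg hκ0 hA0)
    nlinarith
  rcases le_or_gt (h*(1-Q'/2) - h'*(1-Q/2)) 0 with hE | hE
  · -- branch E ≤ 0 :  Φ ≥ base + κσ'A/2 + κ g a' ≥ I₁
    have w1 : κ*(p-q)^2*a' ≤ κ*σ*a' := by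
      have := mul_le_mul_of_nonneg_left hσg hκ0
      exact mul_le_mul_of_nonneg_right this ha'0
    have w2 : 0 ≤ -(κ*D*D'*(h*(1-Q'/2) - h'*(1-Q/2))) := by
      have := mul_nonneg (mul_nonneg (mul_nonneg hκ0 hD) hD') (neg_nonneg.2 hE)
      linarith
    have w3 : κ*(p-q)^2*(1 - 3/2*Q' + (q'-p')^2/2) ≤ κ*(p-q)^2*a' :=
      mul_le_mul_of_nonneg_left haA (mul_nonneg hκ0 (sq_nonneg _))
    linarith
  · -- branch E > 0 : h > 0, hence p > q; τ = (p-q)/(p+q)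
    have hbr0 : 0 ≤ h'*(1-Q/2) := mul_nonneg hh0' hv
    have hhpos : 0 < h := by
      rcases lt_or_eq_of_le hh0 with hlt | heq
      · exact hlt
      · exfalso; rw [← heq, zero_mul] at hE; linarith
    have hpmq : 0 < p - q := by
      rcases lt_or_eq_of_le (sub_nonneg.2 hqp) with hlt | heq
      · exact hlt
      · exfalso; rw [hfac, ← heq, zero_mul] at hhpos; exact lt_irrefl _ hhpos
    have hppq : 0 < p + q := by linarith
    have hppq_ne : p + q ≠ 0 := ne_of_gt hppq
    set τ := (p-q)/(p+q) with hτdef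
    have hτ0 : 0 ≤ τ := div_nonneg (le_of_lt hpmq) (le_of_lt hppq)
    have hτmul : τ*(p+q) = p-q := div_mul_cancel₀ (p-q) hppq_ne
    have hhτ : h = τ*(p+q)^2 := by
      rw [hfac, ← hτmul]; ring
    have hgτ : (p-q)^2 = τ*h := by
      rw [hhτ, ← hτmul]; ring
    have hbr : 0 ≤ h*Q'/2 + h'*(1-Q/2) := by
      have := mul_nonneg hh0 hQ0'
      linarith
    have hE0 : 0 ≤ h*(1-Q'/2) - h'*(1-Q/2) := le_of_lt hE
    -- W := κσa' − κDD'E ≥ κ a' τ (hQ'/2 + h'(1−Q/2))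
    have hW : κ*a'*τ*(h*Q'/2 + h'*(1-Q/2)) ≤ κ*σ*a' - κ*D*D'*(h*(1-Q'/2) - h'*(1-Q/2)) := by
      rcases le_or_gt τ D with hDτ | hDτ
      · -- F-branch: σ ≥ hD, D' ≤ a', D ≥ τ
        have w1 : (κ*D*(h*(1-Q'/2) - h'*(1-Q/2)))*D' ≤ (κ*D*(h*(1-Q'/2) - h'*(1-Q/2)))*a' :=
          mul_le_mul_of_nonneg_left hbc (mul_nonneg (mul_nonneg hκ0 hD) hE0)
        have w2 : τ*(h*Q'/2 + h'*(1-Q/2)) ≤ σ - D*(h*(1-Q'/2) - h'*(1-Q/2)) := by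
          have e : σ - D*(h*(1-Q'/2) - h'*(1-Q/2)) - D*(h*Q'/2 + h'*(1-Q/2)) = σ - h*D := by ring
          have s2 : τ*(h*Q'/2 + h'*(1-Q/2)) ≤ D*(h*Q'/2 + h'*(1-Q/2)) := mul_le_mul_of_nonneg_right hDτ hbr
          linarith
        have w3 := mul_le_mul_of_nonneg_left w2 (mul_nonneg hκ0 ha'0)
        have e1 : κ*a'*(τ*(h*Q'/2 + h'*(1-Q/2))) = κ*a'*τ*(h*Q'/2 + h'*(1-Q/2)) := by ring
        have e2 : κ*a'*(σ - D*(h*(1-Q'/2) - h'*(1-Q/2)))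
            = κ*σ*a' - (κ*D*(h*(1-Q'/2) - h'*(1-Q/2)))*a' := by ring
        have e3 : (κ*D*(h*(1-Q'/2) - h'*(1-Q/2)))*D' = κ*D*D'*(h*(1-Q'/2) - h'*(1-Q/2)) := by ring
        linarith
      · -- A-branch: σ ≥ g, D ≤ τ, D' ≤ a', g = τ h
        have hDτ' : D ≤ τ := le_of_lt hDτ
        have w1 : κ*(p-q)^2*a' ≤ κ*σ*a' := by
          have := mul_le_mul_of_nonneg_left hσg hκ0
          exact mul_le_mul_of_nonneg_right this ha'0
        have w2 : (κ*D'*(h*(1-Q'/2) - h'*(1-Q/2)))*D ≤ (κ*D'*(h*(1-Q'/2) - h'*(1-Q/2)))*τ :=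
          mul_le_mul_of_nonneg_left hDτ' (mul_nonneg (mul_nonneg hκ0 hD') hE0)
        have w3 : (κ*τ*(h*(1-Q'/2) - h'*(1-Q/2)))*D' ≤ (κ*τ*(h*(1-Q'/2) - h'*(1-Q/2)))*a' :=
          mul_le_mul_of_nonneg_left hbc (mul_nonneg (mul_nonneg hκ0 hτ0) hE0)
        have e : κ*(p-q)^2*a' - (κ*τ*(h*(1-Q'/2) - h'*(1-Q/2)))*a' = κ*a'*τ*(h*Q'/2 + h'*(1-Q/2)) := by
          rw [hgτ]; ring
        have e2 : (κ*D'*(h*(1-Q'/2) - h'*(1-Q/2)))*D = κ*D*D'*(h*(1-Q'/2) - h'*(1-Q/2)) := by ring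
        have e3 : (κ*D'*(h*(1-Q'/2) - h'*(1-Q/2)))*τ = (κ*τ*(h*(1-Q'/2) - h'*(1-Q/2)))*D' := by ring
        linarith
    have hY : κ*(1 - 3/2*Q' + (q'-p')^2/2)*τ*(h*Q'/2 + h'*(1-Q/2)) ≤ κ*a'*τ*(h*Q'/2 + h'*(1-Q/2)) := by
      have e1 : κ*(1 - 3/2*Q' + (q'-p')^2/2)*τ*(h*Q'/2 + h'*(1-Q/2))
          = (1 - 3/2*Q' + (q'-p')^2/2)*(κ*τ*(h*Q'/2 + h'*(1-Q/2))) := by ring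
      have e2 : κ*a'*τ*(h*Q'/2 + h'*(1-Q/2)) = a'*(κ*τ*(h*Q'/2 + h'*(1-Q/2))) := by ring
      rw [e1, e2]
      exact mul_le_mul_of_nonneg_right haA (mul_nonneg (mul_nonneg hκ0 hτ0) hbr)
    have hI3 := conjF_union_coreI3 Q Q' h h' ((q'-p')^2) κ (1 - 3/2*Q' + (q'-p')^2/2) τ ((p+q)^2)
      hQ0 hQ hQ0' hQ' hh0 hhQ hh0' hhQ' (sq_nonneg _) hκQ (by
        have := sq_nonneg (q'-p'); linarith) hτ0 hm2 hhτ
    linarith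

end APL

end Summit.CriticalPhenomena.PercolationContinuityZ3.Theorems
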